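import Summits.AnomalousDissipation.AnomalousDissipation.Statement
import Summits.AnomalousDissipation.AnomalousDissipation.Theorems.SoloInformedFluxWindow
import Literature.Analysis.FluidPDE.LongTimeAverageSlidingWindow
import Literature.Analysis.FluidPDE.LongTimeAverageShift
import Literature.Analysis.FluidPDE.LongTimeAverageNonneg
import Literature.Analysis.FluidPDE.LerayHopfGeneralizedEnergyIneq
import Literature.Analysis.FluidPDE.LerayHopfRestart
import Literature.Analysis.FluidPDE.LerayHopfRestartTorus
import Literature.Analysis.FluidPDE.LerayHopfUniformEnergyMomentum
import Literature.Analysis.FluidPDE.DoeringFoiasPowerProofs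
import Literature.Analysis.FunctionSpaces.BesovDifferenceProofs
import Literature.Analysis.FunctionSpaces.TorusMollifierEstimates
import Literature.Analysis.FunctionSpaces.TorusFluidGlueProofs
import HarnessLib

/-!
# Solo (informed) — W11: the long-time flux floor at every fixed scale (Onsager-critical form)

A necessary condition on every witness of `AnomalousDissipation`, in the summit's exact setting
(ONE steady smooth force, long-time `limsup` means, Leray–Hopf class, arbitrary data), with NO
regularity hypothesis.  With `ω(v; ℓ) = sup_{0<‖y‖≤ℓ} ‖v(· + y) - v‖_{L³}/‖y‖^{1/3}`
(`eLocDiffModulus (1/3) 3`) — so `ω(v; ℓ)³ = sup_{0<‖y‖≤ℓ} S₃^{abs}(v; y)/‖y‖`, the compensated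
absolute third-order structure function over scales `≤ ℓ` — put
`Ω(u; ℓ) = limsup_{T→∞} T⁻¹∫₀ᵀ ω(u(t); ℓ)³ dt ∈ [0, ∞]`.

* `lerayHopf_meanDissipation_le_structureMean` — global Leray–Hopf solution on `T^d`
  (`2 ≤ d ≤ 4`), viscosity `ν`, steady smooth divergence-free mean-zero force `f`, ANY datum,
  `0 < ℓ ≤ 1/4`, `λ > 0`, `C` any constant of the CCFS local flux estimate:
  `⟨ν‖∇u‖₂²⟩ ≤ C·Ω(u; ℓ) + ν(4d²C₁²/ℓ²)⟨‖u‖₂²⟩ + 2d[f]_{B¹_{2,∞}} ℓ (λ + ⟨‖u‖₂²⟩/λ)` in `[0,∞]`.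
* `fluxFloor_of_vanishingViscosity` / `anomalousDissipation_imp_fluxFloor` — along every
  witness family (`⟨‖u_j‖₂²⟩ ≤ E`, `⟨ν_j‖∇u_j‖₂²⟩ ≥ ε`): for all `0 < ℓ ≤ 1/4`, `λ > 0`, `j`,
  `ε ≤ C·Ω(u_j; ℓ) + ν_j(36C₁²/ℓ²)E + 6[f]ℓ(λ + E/λ)`.

Reading.  The bound lives in `[0, ∞]` and is non-trivial exactly when `Ω(u; ℓ) < ∞`, i.e. when
the increments of `u` are locally `B^{1/3}_{3,∞}` in long-time `L³` mean: it is the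
ONSAGER-CRITICAL, LOCAL (CCFS `B^{1/3}_{3,c₀}`-type) long-time statement, where the `σ > 1/3`
bounds of `SoloInformedLongTimeOnsager` (W6) are silent and whose global-Besov version at
`σ = 1/3` it sharpens (`Ω(u; ℓ)` only sees scales `≤ ℓ`).  Consequences for a witness with
`ε > 0`: (i) `limsup_{ℓ→0} limsup_j Ω(u_j; ℓ) ≥ ε/C` — the compensated structure function does
not vanish at small scales uniformly in `j` (no uniform `B^{1/3}_{3,c₀}`); (ii) at every FIXED
`ℓ ≤ cε`, `liminf_j Ω(u_j; ℓ) ≥ ε/(2C)`: wherever finite, the long-time mean of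
`sup_{‖y‖≤ℓ} S₃^{abs}(y)/‖y‖` is bounded below uniformly in the inviscid limit — linear
(`ζ₃ ≤ 1`-type) lower scaling of absolute third-order structure functions, the summit-setting
form of the `4/5`-law lower bound (Eyink 2024 §3.1.3 (3.21); Drivas 2022 §2(c)), here for ONE
steady force and `limsup` time averages.  Proof: restart at a time `s` with `u(s) ∈ L²`
(`exists_isGlobalLerayHopf_translate`), the fixed-scale window inequality of
`SoloInformedFluxWindow` on `[s, T]`, the transient is `O(1)/T`, and the energy running mean is
a genuine `limsup` by `isBoundedUnder_timeMean_energy` (this is where mean-zero forcing enters).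
-/

open MeasureTheory Filter Topology Set Function
open scoped ENNReal NNReal InnerProductSpace RealInnerProductSpace

namespace Summit.AnomalousDissipation.AnomalousDissipation.Theorems

open Literature.Analysis Literature.Analysis.FunctionSpaces Literature.Analysis.FluidPDE

variable {d : Type*} [Fintype d] [DecidableEq d]

/-- **W11 — the long-time flux floor at a fixed scale (one solution).** Let `u` be a global
Leray–Hopf solution on `T^d` (`2 ≤ d ≤ 4`) with viscosity `ν > 0`, steady smooth
divergence-free mean-zero force `f` and ARBITRARY datum, and let `C` be a constant of the CCFS
local flux estimate (`Torus.abs_cetFlux_le_eLocDiffModulus_holds`).  For every `0 < ℓ ≤ 1/4`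
and `λ > 0`, in `[0, ∞]`:
`⟨ν‖∇u‖₂²⟩ ≤ C·Ω(u; ℓ) + ν(4d²C₁²/ℓ²)⟨‖u‖₂²⟩ + 2d [f]_{B¹_{2,∞}} ℓ (λ + ⟨‖u‖₂²⟩/λ)`, where
`Ω(u; ℓ) = limsup_T T⁻¹∫₀ᵀ ω(u(t); ℓ)³ dt` and `⟨·⟩` are the summit's `limsup` means.  No
regularity of `u` is assumed (restart at a time `s` with `u(s) ∈ L²`, the window inequality on
`[s, T]`, the transient is `O(1)/T`). [cite: DrivasEyink2019, Lemma 1; Eyink2024, §3.1.3] -/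
theorem lerayHopf_meanDissipation_le_structureMean (hd2 : 2 ≤ Fintype.card d)
    (hd4 : Fintype.card d ≤ 4) {C : ℝ≥0}
    (hC : ∀ {v : UnitAddTorus d → EuclideanSpace ℝ d} (_ : MemLp v 3 volume)
      (_ : Torus.IsWeaklyDivFree v) {ε : ℝ} (_ : 0 < ε) (_ : ε ≤ 1 / 4),
      ENNReal.ofReal |Torus.cetFlux (Torus.kernel ε) v| ≤ C * eLocDiffModulus (1 / 3) 3 v volume ε ^ 3)
    {ν ℓ lam : ℝ} (hν : 0 < ν) (hℓ : 0 < ℓ) (hℓ' : ℓ ≤ 1 / 4) (hlam : 0 < lam)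
    {f : UnitAddTorus d → EuclideanSpace ℝ d} (hf : Torus.IsSmooth f) (hdiv : Torus.IsDivFree f)
    (hmean : Torus.HasZeroMean f) {u₀ : UnitAddTorus d → EuclideanSpace ℝ d}
    {u : ℝ → UnitAddTorus d → EuclideanSpace ℝ d} (hu : Torus.IsGlobalLerayHopf ν (fun _ => f) u₀ u) :
    ENNReal.ofReal (meanDissipation ν u) ≤
      C * limsup (fun T => (∫⁻ t in Ioo 0 T, eLocDiffModulus (1 / 3) 3 (u t) volume ℓ ^ 3) /
          ENNReal.ofReal T) atTop +
      ENNReal.ofReal (ν * (4 * (Fintype.card d : ℝ) ^ 2 * Torus.gradProfileMass d ^ 2 / ℓ ^ 2) *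
          meanEnergy u +
        2 * Fintype.card d * (eBesovSupSeminorm 1 2 f volume).toReal * ℓ * (lam + meanEnergy u / lam)) := by
  set D : ℝ := (Fintype.card d : ℝ) with hD
  set κ₁ : ℝ := ν * (4 * D ^ 2 * Torus.gradProfileMass d ^ 2 / ℓ ^ 2) with hκ₁
  set F₁ : ℝ := (eBesovSupSeminorm 1 2 f volume).toReal with hF₁
  set Ē : ℝ := meanEnergy u with hĒ
  set g : ℝ → ℝ≥0∞ := fun T => (∫⁻ t in Ioo 0 T, eLocDiffModulus (1 / 3) 3 (u t) volume ℓ ^ 3) /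
    ENNReal.ofReal T with hg
  have hD0 : 0 ≤ D := Nat.cast_nonneg _
  have hF₁0 : 0 ≤ F₁ := ENNReal.toReal_nonneg
  have hκ₁0 : 0 ≤ κ₁ := by positivity
  have hĒ0 : 0 ≤ Ē := meanEnergy_nonneg u
  by_cases htop : (C : ℝ≥0∞) * limsup g atTop = ⊤
  · rw [htop, top_add]; exact le_top
  set M : ℝ := ((C : ℝ≥0∞) * limsup g atTop).toReal with hM
  have hM0 : 0 ≤ M := ENNReal.toReal_nonneg
  have hrest0 : 0 ≤ κ₁ * Ē + 2 * D * F₁ * ℓ * (lam + Ē / lam) := by positivity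
  suffices hreal : meanDissipation ν u ≤ M + (κ₁ * Ē + 2 * D * F₁ * ℓ * (lam + Ē / lam)) by
    calc ENNReal.ofReal (meanDissipation ν u)
        ≤ ENNReal.ofReal (M + (κ₁ * Ē + 2 * D * F₁ * ℓ * (lam + Ē / lam))) :=
          ENNReal.ofReal_le_ofReal hreal
      _ = (C : ℝ≥0∞) * limsup g atTop + ENNReal.ofReal (κ₁ * Ē + 2 * D * F₁ * ℓ * (lam + Ē / lam)) := by
          rw [ENNReal.ofReal_add hM0 hrest0, ENNReal.ofReal_toReal htop]
  -- (1) the force modulus at scale `ℓ`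
  have hFfin : eBesovSupSeminorm 1 2 f volume ≠ ⊤ :=
    (Torus.IsSmooth.memBesovSup_holds hf (le_refl (1 : ℝ)) 2).2.ne
  set Af : ℝ≥0∞ := eBesovSupSeminorm 1 2 f volume * ENNReal.ofReal ℓ with hAfdef
  have hAf : Af ≠ ⊤ := ENNReal.mul_ne_top hFfin ENNReal.ofReal_ne_top
  have hAfy : ∀ (t : ℝ) (y : UnitAddTorus d), ‖y‖ ≤ ℓ →
      eLpNorm (fun x => f (x - y) - f x) 2 volume ≤ Af := fun _ y hy => by
    simpa [Real.rpow_one] using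
      Torus.eLpNorm_comp_sub_sub_le_eBesovSupSeminorm (θ := f) (p := 2) one_pos hy
  have hAfR : Af.toReal = F₁ * ℓ := by rw [hAfdef, ENNReal.toReal_mul, ENNReal.toReal_ofReal hℓ.le]
  -- (2) restart at a good time `s`; the transient constant `S`
  obtain ⟨s, hs0, -, hus⟩ := hu.exists_isGlobalLerayHopf_translate hf hν.le
  have hmemS : MemLp (u s) 2 volume := hu.memLp_two hs0.le
  have hwdiv : Torus.IsWeaklyDivFree f := Torus.IsDivFree.isWeaklyDivFree_holds hf hdiv
  have hfst : ∀ T : ℝ, ∫⁻ _ in Ioo (0 : ℝ) T, ∫⁻ x, ‖f x‖ₑ ^ 2 < ⊤ := fun T => by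
    rw [setLIntegral_const, Torus.lintegral_enorm_sq_eq_ofReal (hf.memLp 2)]
    exact ENNReal.mul_lt_top ENNReal.ofReal_lt_top measure_Ioo_lt_top
  have hD₀ : ∫⁻ t in Ioc 0 s, Torus.eGradNormSq (u t) < ⊤ := by
    rw [setLIntegral_congr Ioo_ae_eq_Ioc.symm]; exact (hu s hs0).lintegral_eGradNormSq_lt_top
  set S : ℝ := ν * (∫⁻ t in Ioc 0 s, Torus.eGradNormSq (u t)).toReal + Torus.kineticEnergy (u s)
    with hSdef
  have hS0 : 0 ≤ S :=
    add_nonneg (mul_nonneg hν.le ENNReal.toReal_nonneg) (Torus.kineticEnergy_nonneg _)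
  have hWi : ∀ T, 0 < T → IntegrableOn (fun t => ∫ x, ‖u t x‖ ^ 2) (Ioo 0 T) := fun T hT =>
    (hu T hT).integrableOn_integral_norm_sq
  have hW0 : ∀ t, 0 ≤ ∫ x, ‖u t x‖ ^ 2 := fun t => integral_nonneg fun x => by positivity
  -- (3) the window inequality on `[s, T]`, transported back to `u`
  have hwin : ∀ T, s < T →
      ν * (∫⁻ t in Ioo 0 T, Torus.eGradNormSq (u t)).toReal ≤
        S + (∫ t in Ioo 0 (T - s), |Torus.cetFlux (Torus.kernel ℓ) (u (t + s))|) +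
          (κ₁ + 2 * D * (F₁ * ℓ) / lam) * (∫ t in Ioo 0 T, ∫ x, ‖u t x‖ ^ 2) +
          2 * D * (F₁ * ℓ) * lam * T ∧
      ENNReal.ofReal (∫ t in Ioo 0 (T - s), |Torus.cetFlux (Torus.kernel ℓ) (u (t + s))|) ≤
        C * ∫⁻ t in Ioo 0 T, eLocDiffModulus (1 / 3) 3 (u t) volume ℓ ^ 3 := by
    intro T hsT
    have hT : 0 < T - s := sub_pos.2 hsT
    have hT0 : 0 < T := hs0.trans hsT
    have hLH := hus (T - s) hT
    obtain ⟨hIflux, hw⟩ := lerayHopfOn_dissipation_le_fixedScale hd2 hd4 hT hν hℓ hℓ' hlam hLH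
      (fun _ => hwdiv) (aestronglyMeasurable_stLift_steady hf.continuous _) (hfst _)
      (fun _ => hf.memLp 2) hmemS hAf hAfy
    rw [hAfR, ← hD, ← hκ₁] at hw
    have ha := setLIntegral_Ioo_comp_add_right (fun t => Torus.eGradNormSq (u t)) 0 (T - s) s
    have hb := setLIntegral_Ioo_comp_add_right
      (fun t => eLocDiffModulus (1 / 3) 3 (u t) volume ℓ ^ 3) 0 (T - s) s
    have hc := setIntegral_Ioo_comp_add_right (fun t => ∫ x, ‖u t x‖ ^ 2) 0 (T - s) s
    simp only [zero_add, sub_add_cancel] at ha hb hc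
    have hsub : Ioo s T ⊆ Ioo 0 T := Ioo_subset_Ioo_left hs0.le
    refine ⟨?_, ?_⟩
    · have hfinT : ∫⁻ t in Ioo s T, Torus.eGradNormSq (u t) < ⊤ :=
        lt_of_le_of_lt (lintegral_mono_set hsub) (hu T hT0).lintegral_eGradNormSq_lt_top
      have hdR : (∫⁻ t in Ioo 0 T, Torus.eGradNormSq (u t)).toReal ≤
          (∫⁻ t in Ioc 0 s, Torus.eGradNormSq (u t)).toReal +
            (∫⁻ t in Ioo s T, Torus.eGradNormSq (u t)).toReal := by
        rw [← ENNReal.toReal_add hD₀.ne hfinT.ne]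
        exact ENNReal.toReal_mono (ENNReal.add_ne_top.2 ⟨hD₀.ne, hfinT.ne⟩)
          ((lintegral_mono_set Ioo_subset_Ioc_union_Ioo).trans (lintegral_union_le _ _ _))
      have hcW : ∫ t in Ioo 0 (T - s), ∫ x, ‖u (t + s) x‖ ^ 2 ≤ ∫ t in Ioo 0 T, ∫ x, ‖u t x‖ ^ 2 := by
        rw [hc]
        exact setIntegral_mono_set (hWi T hT0) (Eventually.of_forall hW0) hsub.eventuallyLE
      have h1 := mul_le_mul_of_nonneg_left hdR hν.le
      have h2 : (κ₁ + 2 * D * (F₁ * ℓ) / lam) * (∫ t in Ioo 0 (T - s), ∫ x, ‖u (t + s) x‖ ^ 2) ≤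
          (κ₁ + 2 * D * (F₁ * ℓ) / lam) * (∫ t in Ioo 0 T, ∫ x, ‖u t x‖ ^ 2) :=
        mul_le_mul_of_nonneg_left hcW (by positivity)
      have h3 : 2 * D * (F₁ * ℓ) * lam * (T - s) ≤ 2 * D * (F₁ * ℓ) * lam * T :=
        mul_le_mul_of_nonneg_left (by linarith) (by positivity)
      rw [ha] at hw
      rw [mul_add] at h1
      linarith
    · calc ENNReal.ofReal (∫ t in Ioo 0 (T - s), |Torus.cetFlux (Torus.kernel ℓ) (u (t + s))|)
          ≤ C * ∫⁻ t in Ioo 0 (T - s), eLocDiffModulus (1 / 3) 3 (u (t + s)) volume ℓ ^ 3 :=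
            lerayHopfOn_ofReal_integral_abs_cetFlux_le hd2 hd4 hC hLH hℓ hℓ' hIflux
        _ ≤ C * ∫⁻ t in Ioo 0 T, eLocDiffModulus (1 / 3) 3 (u t) volume ℓ ^ 3 := by
            rw [hb]; exact mul_le_mul_right (lintegral_mono_set hsub) _
  -- (4) eventual bounds for the flux mean and the energy mean
  have hflux : ∀ δ : ℝ, 0 < δ → ∀ᶠ T in atTop, (C : ℝ≥0∞) * g T ≤ (C : ℝ≥0∞) * limsup g atTop +
      ENNReal.ofReal δ := by
    intro δ hδ
    by_cases hC0 : C = 0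
    · exact Eventually.of_forall fun T => by simp [hC0]
    have hC0' : (C : ℝ≥0∞) ≠ 0 := by exact_mod_cast hC0
    have hΩ : limsup g atTop ≠ ⊤ := fun h => htop (by rw [h, ENNReal.mul_top hC0'])
    have hη : ENNReal.ofReal δ / C ≠ 0 :=
      (ENNReal.div_pos (ENNReal.ofReal_pos.2 hδ).ne' ENNReal.coe_ne_top).ne'
    filter_upwards [eventually_lt_of_limsup_lt (ENNReal.lt_add_right hΩ hη)] with T hT
    calc (C : ℝ≥0∞) * g T ≤ C * (limsup g atTop + ENNReal.ofReal δ / C) := mul_le_mul_right hT.le _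
      _ = C * limsup g atTop + ENNReal.ofReal δ := by
          rw [mul_add, ENNReal.mul_div_cancel hC0' ENNReal.coe_ne_top]
  have hbdd := hu.isBoundedUnder_timeMean_energy hν (hf.memLp 2) hmean
  -- (5) the running means
  set K₂ : ℝ := κ₁ + 2 * D * (F₁ * ℓ) / lam with hK₂
  have hK₂0 : 0 ≤ K₂ := by positivity
  have hmeanT : ∀ δ : ℝ, 0 < δ → ∀ᶠ T in atTop,
      timeMean (fun t => ν * (Torus.eGradNormSq (u t)).toReal) T ≤
        M + (κ₁ * Ē + 2 * D * F₁ * ℓ * (lam + Ē / lam)) + (2 + K₂) * δ := by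
    intro δ hδ
    have hElt : limsup (timeMean fun t => ∫ x, ‖u t x‖ ^ 2) atTop < Ē + δ := by
      rw [hĒ]; exact lt_add_of_pos_right _ hδ
    filter_upwards [eventually_gt_atTop s, hflux δ hδ, eventually_lt_of_limsup_lt hElt hbdd,
      eventually_ge_atTop (S / δ)] with T hsT hgT hET hSδ
    have hT0 : 0 < T := hs0.trans hsT
    have hST : S ≤ δ * T := by have := (div_le_iff₀ hδ).1 hSδ; linarith [mul_comm T δ]
    obtain ⟨hw, hF⟩ := hwin T hsT
    have hDint := (hu.setIntegral_toReal_eGradNormSq (s := 0) (t := T) le_rfl).2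
    -- the flux term is at most `(M + δ) T`
    have hTne : ENNReal.ofReal T ≠ 0 := (ENNReal.ofReal_pos.2 hT0).ne'
    have hgT' : (C : ℝ≥0∞) * ∫⁻ t in Ioo 0 T, eLocDiffModulus (1 / 3) 3 (u t) volume ℓ ^ 3 ≤
        ENNReal.ofReal ((M + δ) * T) := by
      have : (∫⁻ t in Ioo 0 T, eLocDiffModulus (1 / 3) 3 (u t) volume ℓ ^ 3) = g T * ENNReal.ofReal T := by
        rw [hg, ENNReal.div_mul_cancel hTne ENNReal.ofReal_ne_top]
      rw [this, ← mul_assoc, ENNReal.ofReal_mul (by positivity : (0 : ℝ) ≤ M + δ),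
        ENNReal.ofReal_add hM0 hδ.le, hM, ENNReal.ofReal_toReal htop]
      exact mul_le_mul_left hgT _
    have hFr : (∫ t in Ioo 0 (T - s), |Torus.cetFlux (Torus.kernel ℓ) (u (t + s))|) ≤ (M + δ) * T :=
      (ENNReal.ofReal_le_ofReal_iff (by positivity)).1 (hF.trans hgT')
    -- the energy term is at most `(Ē + δ) T`
    have hWT : (∫ t in Ioo 0 T, ∫ x, ‖u t x‖ ^ 2) ≤ (Ē + δ) * T := by
      have h1 : timeMean (fun t => ∫ x, ‖u t x‖ ^ 2) T = T⁻¹ * ∫ t in Ioo 0 T, ∫ x, ‖u t x‖ ^ 2 := by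
        unfold timeMean; rw [intervalIntegral.integral_of_le hT0.le, integral_Ioc_eq_integral_Ioo]
      rw [h1] at hET
      have := (inv_mul_le_iff₀ hT0).1 hET.le
      linarith [mul_comm T (Ē + δ)]
    have hw' : ν * (∫⁻ t in Ioo 0 T, Torus.eGradNormSq (u t)).toReal ≤
        (M + (κ₁ * Ē + 2 * D * F₁ * ℓ * (lam + Ē / lam)) + (2 + K₂) * δ) * T := by
      have h2 := mul_le_mul_of_nonneg_left hWT hK₂0
      have : (M + (κ₁ * Ē + 2 * D * F₁ * ℓ * (lam + Ē / lam)) + (2 + K₂) * δ) * T =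
          δ * T + (M + δ) * T + K₂ * ((Ē + δ) * T) + 2 * D * (F₁ * ℓ) * lam * T := by
        rw [hK₂]; field_simp; ring
      rw [this]; linarith
    unfold timeMean
    rw [intervalIntegral.integral_of_le hT0.le, integral_const_mul, hDint]
    calc T⁻¹ * (ν * (∫⁻ τ in Ioo 0 T, Torus.eGradNormSq (u τ)).toReal)
        ≤ T⁻¹ * ((M + (κ₁ * Ē + 2 * D * F₁ * ℓ * (lam + Ē / lam)) + (2 + K₂) * δ) * T) :=
          mul_le_mul_of_nonneg_left hw' (inv_nonneg.2 hT0.le)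
      _ = M + (κ₁ * Ē + 2 * D * F₁ * ℓ * (lam + Ē / lam)) + (2 + K₂) * δ := by
          field_simp
  -- (6) pass to the limsup
  show longTimeAvgSup (fun t => ν * (Torus.eGradNormSq (u t)).toReal) ≤ _
  refine le_of_forall_pos_le_add fun δ₀ hδ₀ => ?_
  refine longTimeAvgSup_le_of_eventually_le (fun t => mul_nonneg hν.le ENNReal.toReal_nonneg) ?_
  have h2K : 0 < 2 + K₂ := by positivity
  filter_upwards [hmeanT (δ₀ / (2 + K₂)) (div_pos hδ₀ h2K)] with T hT
  rwa [mul_div_cancel₀ _ h2K.ne'] at hT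

/-- **W11 for witness families — the flux floor under vanishing viscosity.** There is a
dimensional constant `C` such that for every steady smooth divergence-free mean-zero force `f`
on `T³` and every family of global Leray–Hopf solutions `u_j` (viscosities `ν_j > 0`, arbitrary
data) with `⟨‖u_j‖₂²⟩ ≤ E` and `⟨ν_j‖∇u_j‖₂²⟩ ≥ ε`, at every fixed scale `0 < ℓ ≤ 1/4` and for
every `λ > 0` and every `j`:
`ε ≤ C·Ω(u_j; ℓ) + ν_j (36 C₁²/ℓ²) E + 6 [f]_{B¹_{2,∞}} ℓ (λ + E/λ)` in `[0, ∞]`.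
In particular, if `ε > 0` (a witness of `AnomalousDissipation`), then for `ℓ ≤ cε` and
`j → ∞` the long-time mean of the compensated third-order absolute structure function
`sup_{‖y‖≤ℓ} S₃(u_j; y)/‖y‖` stays `≥ ε/(2C)`: linear ("`ζ₃ ≤ 1`") scaling at every fixed
scale in the inviscid limit, the summit-setting form of the `4/5`-law lower bound. [cite: Eyink2024, §3.1.3 (3.21); Drivas2022, §2(c)] -/
theorem fluxFloor_of_vanishingViscosity :
    ∃ C : ℝ≥0, ∀ {f : UnitAddTorus (Fin 3) → EuclideanSpace ℝ (Fin 3)} (_ : Torus.IsSmooth f)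
      (_ : Torus.IsDivFree f) (_ : Torus.HasZeroMean f) {ν : ℕ → ℝ}
      {u₀ : ℕ → UnitAddTorus (Fin 3) → EuclideanSpace ℝ (Fin 3)}
      {u : ℕ → ℝ → UnitAddTorus (Fin 3) → EuclideanSpace ℝ (Fin 3)} {E ε : ℝ} (_ : ∀ j, 0 < ν j)
      (_ : ∀ j, Torus.IsGlobalLerayHopf (ν j) (fun _ => f) (u₀ j) (u j))
      (_ : ∀ j, meanEnergy (u j) ≤ E) (_ : ∀ j, ε ≤ meanDissipation (ν j) (u j))
      {ℓ lam : ℝ} (_ : 0 < ℓ) (_ : ℓ ≤ 1 / 4) (_ : 0 < lam) (j : ℕ),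
      ENNReal.ofReal ε ≤
        C * limsup (fun T => (∫⁻ t in Ioo 0 T, eLocDiffModulus (1 / 3) 3 (u j t) volume ℓ ^ 3) /
            ENNReal.ofReal T) atTop +
        ENNReal.ofReal (ν j * (36 * Torus.gradProfileMass (Fin 3) ^ 2 / ℓ ^ 2) * E +
          6 * (eBesovSupSeminorm 1 2 f volume).toReal * ℓ * (lam + E / lam)) := by
  obtain ⟨C, hC⟩ := Torus.abs_cetFlux_le_eLocDiffModulus_holds (d := Fin 3)
  refine ⟨C, ?_⟩
  intro f hf hdiv hmean ν u₀ u E ε hν hu hE hε ℓ lam hℓ hℓ' hlam j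
  have hE0 : 0 ≤ E := (meanEnergy_nonneg (u j)).trans (hE j)
  have h := lerayHopf_meanDissipation_le_structureMean (d := Fin 3) (by simp) (by simp) hC (hν j)
    hℓ hℓ' hlam hf hdiv hmean (hu j)
  simp only [Fintype.card_fin, Nat.cast_ofNat] at h
  refine (ENNReal.ofReal_le_ofReal (hε j)).trans (h.trans (add_le_add le_rfl (ENNReal.ofReal_le_ofReal ?_)))
  have hF0 : 0 ≤ (eBesovSupSeminorm 1 2 f volume).toReal := ENNReal.toReal_nonneg
  have hC₁ : 0 ≤ Torus.gradProfileMass (Fin 3) := Torus.gradProfileMass_nonneg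
  have h1 : lam + meanEnergy (u j) / lam ≤ lam + E / lam := by gcongr; exact hE j
  have h2 : ν j * (4 * (3 : ℝ) ^ 2 * Torus.gradProfileMass (Fin 3) ^ 2 / ℓ ^ 2) * meanEnergy (u j) ≤
      ν j * (36 * Torus.gradProfileMass (Fin 3) ^ 2 / ℓ ^ 2) * E := by
    rw [show (4 : ℝ) * 3 ^ 2 = 36 by norm_num]
    exact mul_le_mul_of_nonneg_left (hE j) (by have := (hν j).le; positivity)
  have h3 : 2 * 3 * (eBesovSupSeminorm 1 2 f volume).toReal * ℓ * (lam + meanEnergy (u j) / lam) ≤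
      6 * (eBesovSupSeminorm 1 2 f volume).toReal * ℓ * (lam + E / lam) := by
    rw [show (2 : ℝ) * 3 = 6 by norm_num]
    exact mul_le_mul_of_nonneg_left h1 (by positivity)
  linarith

/-- **Summit-facing reading of W11.** If `AnomalousDissipation` holds, its witness family obeys
the flux floor of `fluxFloor_of_vanishingViscosity` with some `ε > 0`: at every fixed small
scale the inviscid limit carries a non-vanishing mean compensated third-order structure
function — any construction must produce genuinely turbulent (`ζ₃ ≤ 1`) long-time statistics
at all small scales simultaneously, not merely large gradients. [cite: Eyink2024, §3.1.3] -/
theorem anomalousDissipation_imp_fluxFloor (h : AnomalousDissipation) :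
    ∃ (C : ℝ≥0) (f : UnitAddTorus (Fin 3) → EuclideanSpace ℝ (Fin 3)) (ν : ℕ → ℝ)
      (u : ℕ → ℝ → UnitAddTorus (Fin 3) → EuclideanSpace ℝ (Fin 3)) (E ε : ℝ),
      Torus.IsSmooth f ∧ (∀ j, 0 < ν j) ∧ Tendsto ν atTop (𝓝 0) ∧ 0 < ε ∧
      (∀ j, ε ≤ meanDissipation (ν j) (u j)) ∧ (∀ j, meanEnergy (u j) ≤ E) ∧
      ∀ {ℓ lam : ℝ}, 0 < ℓ → ℓ ≤ 1 / 4 → 0 < lam → ∀ j, ENNReal.ofReal ε ≤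
        C * limsup (fun T => (∫⁻ t in Ioo 0 T, eLocDiffModulus (1 / 3) 3 (u j t) volume ℓ ^ 3) /
            ENNReal.ofReal T) atTop +
        ENNReal.ofReal (ν j * (36 * Torus.gradProfileMass (Fin 3) ^ 2 / ℓ ^ 2) * E +
          6 * (eBesovSupSeminorm 1 2 f volume).toReal * ℓ * (lam + E / lam)) := by
  obtain ⟨C, hC⟩ := fluxFloor_of_vanishingViscosity
  obtain ⟨f, hf, hdiv, hmean, ν, u₀, u, hν, hν0, hu, ⟨E, hE⟩, ε, hε, hεj⟩ := h
  exact ⟨C, f, ν, u, E, ε, hf, hν, hν0, hε, hεj, hE, fun hℓ hℓ' hlam j =>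
    hC hf hdiv hmean hν hu hE hεj hℓ hℓ' hlam j⟩

end Summit.AnomalousDissipation.AnomalousDissipation.Theorems
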